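import Literature.Analysis.FluidPDE.PeriodicBoxTorus
import Literature.Analysis.FluidPDE.PeriodicCylinderExtensionBounds
import Literature.Analysis.Calculus.WhitneyConvexPartition
import HarnessLib

/-!
# Transfer of Sobolev energies: period cell → flat torus

Analysis/FluidPDE support file for the energy-method construction of Euler flows in the periodic
cylinder (`Literature.Analysis.FluidPDE.KatoLai1984_periodicCylinderUniformExistence`), step
"extend the datum to the torus" of Kato–Lai's §7, (7.1). For a field `f` which is `C^∞` on the
closed cylinder `{r ≤ 1}` and `L`-periodic in `z`, the torus field
`U = toTorus L (cylExtend f)` (radial Seeley extension read on `T³`, files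
`PeriodicCylinderExtension*`, `PeriodicBoxTorus`) satisfies the **lattice energy bound**

  `∑_k (1 + |k|²)^m ‖Û(k)‖² ≤ C(L, m) · 𝓔_m(f)`,  `𝓔_m(f) = ∑_{l ≤ m} ∫_{cell} ‖Dˡ f‖²`

(`exists_latticeEnergy_toTorus_cylExtend_le`), and the cell energy is controlled by the tree's
Sobolev norm, `𝓔_n(f) ≤ C(n) ‖f‖²_{W^{n,2}(cell L)}` (`exists_cellEnergy_le_eSobolevDomainNorm_sq`).
Together: `H^m(cell)`-data of Kato–Lai's Theorem II become elements of the weighted lattice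
spaces `SymL2` on which the abstract evolution theorem runs, with norm `≤ C ‖φ‖_{H^m(cell)}`.

On the way (reusable in the restriction direction):
* `norm_le_coordBound_pow_mul_sum` — the operator norm of a continuous multilinear map on `ℝ³`
  by its values on the words of a basis;
* `norm_iterDirDeriv_wordVecs_le`, `norm_iteratedFDeriv_le_sum_words` — coordinate word
  derivatives versus `‖Dˡ g(x)‖`;
* `iterDeriv_eq_iterDirDeriv_ofFn` — the tree's two iterated directional derivatives
  (`iterDeriv`, innermost letter first; `iterDirDeriv`, outermost first) agree up to reversal.

Everything is proved; no named fact and no `sorry` is introduced.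

## Mathlib / tree search

Tree: `eSobolevDomainNorm_eq_sum_iterDeriv` (`IteratedSliceDerivatives`), `iterDeriv`,
`iterDirDeriv`, `WhitneyConvex.iterDirDeriv_ofFn_eq_iteratedFDeriv`,
`PeriodicCylinder.exists_lintegral_iteratedFDeriv_cylExtend_le` and `cellEnergy`
(`PeriodicCylinderExtensionBounds`), `PeriodicCylinder.lintegral_wordDeriv_toTorus_sq_le`
(`PeriodicBoxTorus`), `Torus.tsum_weight_mul_norm_sq_le` (`TorusWordSobolev`). Mathlib:
`ContinuousMultilinearMap.map_sum`, `map_smul_univ`, `opNorm_le_bound`, `sq_sum_le_card_mul_sum_sq`,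
`eLpNorm_nnreal_pow_eq_lintegral`, `ofReal_integral_eq_lintegral_ofReal`.

## References

* T. Kato, C. Y. Lai, J. Funct. Anal. 56 (1984) 15–28, §7, (7.1). [KatoLai1984]
* R. T. Seeley, Proc. Amer. Math. Soc. 15 (1964) 625–626. [Seeley1964]
-/

noncomputable section

open MeasureTheory Set Function Filter Topology TopologicalSpace WithLp Finset
open scoped ContDiff NNReal ENNReal

namespace Literature.Analysis.FluidPDE

open FunctionSpaces FunctionSpaces.Torus Calculus.WhitneyConvex UnitAddTorus

/-- Local notation for physical space `ℝ³ = EuclideanSpace ℝ (Fin 3)`. -/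
local notation "ℝ³" => EuclideanSpace ℝ (Fin 3)

/-- Local notation for the closed cylinder `{r ≤ 1}`. -/
local notation "𝕂" => closure (SetLike.coe unitCylinder : Set (EuclideanSpace ℝ (Fin 3)))

namespace PeriodicCylinder

variable {F : Type*} [NormedAddCommGroup F] [NormedSpace ℝ F]

/-! ### Two measure-theoretic conversions -/

omit [NormedSpace ℝ F] in
/-- `‖f‖²_{L²(μ)} = ∫⁻ ‖f‖ₑ²`. [folklore] -/
theorem eLpNorm_two_sq_eq {α : Type*} {_ : MeasurableSpace α} (μ : Measure α) (f : α → F) :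
    eLpNorm f 2 μ ^ 2 = ∫⁻ x, ‖f x‖ₑ ^ 2 ∂μ := by
  have h := eLpNorm_nnreal_pow_eq_lintegral (μ := μ) (f := f) (p := (2 : ℝ≥0)) two_ne_zero
  simp only [ENNReal.coe_ofNat, NNReal.coe_ofNat, ENNReal.rpow_ofNat] at h
  exact h

omit [NormedSpace ℝ F] in
/-- `‖y‖ₑ² = ofReal (‖y‖²)`. [folklore] -/
theorem enorm_sq_eq_ofReal (y : F) : ‖y‖ₑ ^ 2 = ENNReal.ofReal (‖y‖ ^ 2) := by
  rw [← ofReal_norm, ENNReal.ofReal_pow (norm_nonneg _)]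

/-! ### Multilinear maps on `ℝ³`: operator norm by the values on basis words -/

section Basis

variable {ι : Type*} [Fintype ι]

/-- The coordinate bound `K_b = ∑_k ‖b*_k‖` of a basis `b` of `ℝ³`. [folklore] -/
def coordBound (b : Module.Basis ι ℝ ℝ³) : ℝ := ∑ k, ‖LinearMap.toContinuousLinearMap (b.coord k)‖

/-- `K_b ≥ 0`. [folklore] -/
theorem coordBound_nonneg (b : Module.Basis ι ℝ ℝ³) : 0 ≤ coordBound b :=
  sum_nonneg fun _ _ => norm_nonneg _

/-- Coordinates are bounded by `K_b ‖v‖`. [folklore] -/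
theorem abs_repr_le (b : Module.Basis ι ℝ ℝ³) (v : ℝ³) (k : ι) : |b.repr v k| ≤ coordBound b * ‖v‖ := by
  have h1 : |b.repr v k| ≤ ‖LinearMap.toContinuousLinearMap (b.coord k)‖ * ‖v‖ := by
    have := (LinearMap.toContinuousLinearMap (b.coord k)).le_opNorm v
    rwa [LinearMap.coe_toContinuousLinearMap', Module.Basis.coord_apply, Real.norm_eq_abs] at this
  refine h1.trans (mul_le_mul_of_nonneg_right ?_ (norm_nonneg _))
  exact single_le_sum (f := fun k => ‖LinearMap.toContinuousLinearMap (b.coord k)‖)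
    (fun _ _ => norm_nonneg _) (mem_univ k)

/-- **The operator norm of a continuous multilinear map on `ℝ³` by its values on the words of a
basis**: `‖M‖ ≤ K_b^l ∑_{w : Fin l → ι} ‖M (b ∘ w)‖`. [folklore] -/
theorem norm_le_coordBound_pow_mul_sum (b : Module.Basis ι ℝ ℝ³) {l : ℕ} (M : ℝ³ [×l]→L[ℝ] F) :
    ‖M‖ ≤ coordBound b ^ l * ∑ w : Fin l → ι, ‖M fun j => b (w j)‖ := by
  classical
  have hK := coordBound_nonneg b
  refine ContinuousMultilinearMap.opNorm_le_bound (by positivity) fun v => ?_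
  have hv : v = fun j => ∑ k, (b.repr (v j) k) • b k := funext fun j => (b.sum_repr (v j)).symm
  calc ‖M v‖ = ‖M fun j => ∑ k, (b.repr (v j) k) • b k‖ := by rw [← hv]
    _ = ‖∑ w : Fin l → ι, M fun j => (b.repr (v j) (w j)) • b (w j)‖ := by
        rw [ContinuousMultilinearMap.map_sum M fun j k => (b.repr (v j) k) • b k]
    _ = ‖∑ w : Fin l → ι, (∏ j, b.repr (v j) (w j)) • M fun j => b (w j)‖ := by
        congr 1
        refine sum_congr rfl fun w _ => ?_
        rw [ContinuousMultilinearMap.map_smul_univ]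
    _ ≤ ∑ w : Fin l → ι, ‖(∏ j, b.repr (v j) (w j)) • M fun j => b (w j)‖ := norm_sum_le _ _
    _ ≤ ∑ w : Fin l → ι, (coordBound b ^ l * ‖M fun j => b (w j)‖) * ∏ j, ‖v j‖ :=
        sum_le_sum fun w _ => by
          rw [norm_smul, Real.norm_eq_abs, Finset.abs_prod]
          have hp : ∏ j, |b.repr (v j) (w j)| ≤ ∏ j, (coordBound b * ‖v j‖) :=
            prod_le_prod (fun j _ => abs_nonneg _) fun j _ => abs_repr_le b (v j) (w j)
          rw [prod_mul_distrib, prod_const, card_univ, Fintype.card_fin] at hp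
          calc (∏ j, |b.repr (v j) (w j)|) * ‖M fun j => b (w j)‖
              ≤ (coordBound b ^ l * ∏ j, ‖v j‖) * ‖M fun j => b (w j)‖ :=
                mul_le_mul_of_nonneg_right hp (norm_nonneg _)
            _ = _ := by ring
    _ = (coordBound b ^ l * ∑ w : Fin l → ι, ‖M fun j => b (w j)‖) * ∏ j, ‖v j‖ := by
        rw [← sum_mul, ← mul_sum]

/-- The size `B_b = 1 + ∑_k ‖b_k‖` of a basis. [folklore] -/
def vecBound (b : Module.Basis ι ℝ ℝ³) : ℝ := 1 + ∑ k, ‖b k‖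

/-- `B_b ≥ 1`. [folklore] -/
theorem one_le_vecBound (b : Module.Basis ι ℝ ℝ³) : 1 ≤ vecBound b := by
  have : 0 ≤ ∑ k, ‖b k‖ := sum_nonneg fun _ _ => norm_nonneg _
  unfold vecBound; linarith

/-- `‖b_k‖ ≤ B_b`. [folklore] -/
theorem norm_basis_le_vecBound (b : Module.Basis ι ℝ ℝ³) (k : ι) : ‖b k‖ ≤ vecBound b := by
  have := single_le_sum (f := fun k => ‖b k‖) (fun _ _ => norm_nonneg _) (mem_univ k)
  unfold vecBound; linarith

/-- **Values on basis words by the operator norm**: `‖M (b ∘ w)‖ ≤ B_b^l ‖M‖`. [folklore] -/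
theorem norm_apply_basis_le (b : Module.Basis ι ℝ ℝ³) {l : ℕ} (M : ℝ³ [×l]→L[ℝ] F) (w : Fin l → ι) :
    ‖M fun j => b (w j)‖ ≤ vecBound b ^ l * ‖M‖ := by
  refine (M.le_opNorm _).trans ?_
  rw [mul_comm]
  refine mul_le_mul_of_nonneg_right ?_ (norm_nonneg _)
  have hp : ∏ j, ‖b (w j)‖ ≤ ∏ _j : Fin l, vecBound b :=
    prod_le_prod (fun j _ => norm_nonneg _) fun j _ => norm_basis_le_vecBound b (w j)
  rwa [prod_const, card_univ, Fintype.card_fin] at hp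

end Basis

/-! ### Coordinate word derivatives versus `‖Dˡ g(x)‖` -/

/-- The coordinate vectors of `List.ofFn r`. [folklore] -/
theorem wordVecs_ofFn {l : ℕ} (r : Fin l → Fin 3) :
    Torus.wordVecs (List.ofFn r) = List.ofFn fun j => EuclideanSpace.single (r j) (1 : ℝ) := by
  rw [Torus.wordVecs, List.map_ofFn]
  rfl

/-- **Coordinate word derivatives are values of `Dˡ g`** on an open set of smoothness.
[folklore] -/
theorem iterDirDeriv_wordVecs_ofFn_apply {g : ℝ³ → F} {U : Set ℝ³} (hU : IsOpen U) (hg : ContDiffOn ℝ ∞ g U)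
    {l : ℕ} (r : Fin l → Fin 3) {x : ℝ³} (hx : x ∈ U) :
    iterDirDeriv (Torus.wordVecs (List.ofFn r)) g x =
      iteratedFDeriv ℝ l g x fun j => EuclideanSpace.single (r j) (1 : ℝ) := by
  rw [wordVecs_ofFn]
  exact iterDirDeriv_ofFn_eq_iteratedFDeriv hU hg _ hx

/-- **`‖∂_r g(x)‖ ≤ ‖Dˡ g(x)‖`** for coordinate words (unit coordinate vectors). [folklore] -/
theorem norm_iterDirDeriv_wordVecs_le {g : ℝ³ → F} {U : Set ℝ³} (hU : IsOpen U) (hg : ContDiffOn ℝ ∞ g U)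
    {l : ℕ} (r : Fin l → Fin 3) {x : ℝ³} (hx : x ∈ U) :
    ‖iterDirDeriv (Torus.wordVecs (List.ofFn r)) g x‖ ≤ ‖iteratedFDeriv ℝ l g x‖ := by
  rw [iterDirDeriv_wordVecs_ofFn_apply hU hg r hx]
  refine (ContinuousMultilinearMap.le_opNorm _ _).trans (le_of_eq ?_)
  rw [prod_eq_one fun j _ => by simp, mul_one]

/-- **`‖Dˡ g(x)‖ ≤ K^l ∑_r ‖∂_r g(x)‖`** over the coordinate words, `K` the coordinate bound of the
standard basis. [folklore] -/
theorem norm_iteratedFDeriv_le_sum_words {g : ℝ³ → F} {U : Set ℝ³} (hU : IsOpen U) (hg : ContDiffOn ℝ ∞ g U)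
    (l : ℕ) {x : ℝ³} (hx : x ∈ U) :
    ‖iteratedFDeriv ℝ l g x‖ ≤ coordBound (EuclideanSpace.basisFun (Fin 3) ℝ).toBasis ^ l *
      ∑ r : Fin l → Fin 3, ‖iterDirDeriv (Torus.wordVecs (List.ofFn r)) g x‖ := by
  have h := norm_le_coordBound_pow_mul_sum (EuclideanSpace.basisFun (Fin 3) ℝ).toBasis (iteratedFDeriv ℝ l g x)
  refine h.trans (le_of_eq ?_)
  congr 1
  refine sum_congr rfl fun r _ => ?_
  rw [iterDirDeriv_wordVecs_ofFn_apply hU hg r hx]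
  simp only [OrthonormalBasis.coe_toBasis, EuclideanSpace.basisFun_apply]

/-! ### The tree's two iterated directional derivatives -/

/-- **`iterDeriv` (innermost letter first) is `iterDirDeriv` of the reversed word.** [folklore] -/
theorem iterDeriv_eq_iterDirDeriv_ofFn : ∀ (l : ℕ) (v : Fin l → ℝ³) (f : ℝ³ → F),
    iterDeriv l v f = iterDirDeriv (List.ofFn fun j => v (Fin.rev j)) f
  | 0, v, f => by rw [iterDeriv_zero, List.ofFn_zero, iterDirDeriv_nil]
  | l + 1, v, f => by
    rw [iterDeriv_succ, iterDeriv_eq_iterDirDeriv_ofFn l, List.ofFn_succ', List.concat_eq_append,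
      iterDirDeriv_append_singleton, Fin.rev_last]
    congr 2
    funext j
    simp only [Fin.tail, Fin.rev_castSucc]

/-- **`iterDeriv l v f (x) = Dˡ f(x)(v ∘ rev)`** at points of an open set of smoothness (the
tree's `iterDeriv_eq_iteratedFDeriv`, re-derived through `iterDirDeriv`). [folklore] -/
theorem iterDeriv_apply_eq_iteratedFDeriv {f : ℝ³ → F} {U : Set ℝ³} (hU : IsOpen U) (hf : ContDiffOn ℝ ∞ f U)
    (l : ℕ) (v : Fin l → ℝ³) {x : ℝ³} (hx : x ∈ U) :
    iterDeriv l v f x = iteratedFDeriv ℝ l f x fun j => v (Fin.rev j) := by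
  rw [iterDeriv_eq_iterDirDeriv_ofFn]
  exact iterDirDeriv_ofFn_eq_iteratedFDeriv hU hf _ hx

/-! ### The cell energy by the Sobolev norm -/

section CellEnergy

variable [CompleteSpace F]

/-- Each word term of the Sobolev norm is below the norm. [folklore] -/
theorem eLpNorm_iterDeriv_le_eSobolevDomainNorm {L : ℝ} {n l : ℕ} (hl : l ≤ n) {f : ℝ³ → F}
    (hf : ContDiffOn ℝ ∞ f (cylinderCell L : Set ℝ³)) (w : Fin l → Fin (Module.finrank ℝ ℝ³)) :
    eLpNorm (iterDeriv l (fun j => Module.finBasis ℝ ℝ³ (w j)) f) 2 (volume.restrict (cylinderCell L : Set ℝ³)) ≤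
      eSobolevDomainNorm n 2 (cylinderCell L) volume f := by
  rw [eSobolevDomainNorm_eq_sum_iterDeriv 2 n hf]
  refine le_trans ?_ (single_le_sum (f := fun m => ∑ w : Fin m → Fin (Module.finrank ℝ ℝ³),
    eLpNorm (iterDeriv m (fun j => Module.finBasis ℝ ℝ³ (w j)) f) 2 (volume.restrict (cylinderCell L : Set ℝ³)))
    (fun _ _ => zero_le) (mem_range.2 (Nat.lt_succ_of_le hl)))
  exact single_le_sum (f := fun w : Fin l → Fin (Module.finrank ℝ ℝ³) =>
    eLpNorm (iterDeriv l (fun j => Module.finBasis ℝ ℝ³ (w j)) f) 2 (volume.restrict (cylinderCell L : Set ℝ³)))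
    (fun _ _ => zero_le) (mem_univ w)

omit [CompleteSpace F] in
/-- **Pointwise**: `‖Dˡ f(x)‖ ≤ K₀^l ∑_w ‖iterDeriv l (e ∘ w ∘ rev) f (x)‖` on the cell, `e` the
basis `Module.finBasis ℝ ℝ³` of the Sobolev norm and `K₀` its coordinate bound. [folklore] -/
theorem norm_iteratedFDeriv_le_sum_iterDeriv {L : ℝ} {f : ℝ³ → F} (hf : ContDiffOn ℝ ∞ f (cylinderCell L : Set ℝ³))
    (l : ℕ) {x : ℝ³} (hx : x ∈ (cylinderCell L : Set ℝ³)) :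
    ‖iteratedFDeriv ℝ l f x‖ ≤ coordBound (Module.finBasis ℝ ℝ³) ^ l *
      ∑ w : Fin l → Fin (Module.finrank ℝ ℝ³),
        ‖iterDeriv l (fun j => Module.finBasis ℝ ℝ³ (w (Fin.rev j))) f x‖ := by
  have h := norm_le_coordBound_pow_mul_sum (Module.finBasis ℝ ℝ³) (iteratedFDeriv ℝ l f x)
  refine h.trans (le_of_eq ?_)
  congr 1
  refine sum_congr rfl fun w _ => ?_
  rw [iterDeriv_apply_eq_iteratedFDeriv (cylinderCell L).isOpen hf l _ hx]
  simp only [Fin.rev_rev]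

/-- **The cell energy by the Sobolev norm**: `𝓔_n(f) ≤ C(n) ‖f‖²_{W^{n,2}(cell L)}` for `f` smooth
on the open cell, uniformly in `L` and `f`. [folklore] -/
theorem exists_cellEnergy_le_eSobolevDomainNorm_sq (n : ℕ) : ∃ C : ℝ, 0 ≤ C ∧
    ∀ (L : ℝ) (f : ℝ³ → F), ContDiffOn ℝ ∞ f (cylinderCell L : Set ℝ³) →
      cellEnergy L n f ≤ ENNReal.ofReal C * eSobolevDomainNorm n 2 (cylinderCell L) volume f ^ 2 := by
  set K₀ : ℝ := coordBound (Module.finBasis ℝ ℝ³) with hK₀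
  have hK₀0 : 0 ≤ K₀ := coordBound_nonneg _
  -- per-order constant: `K₀^{2l} N_l²`, `N_l` the number of words of length `l`
  set c : ℕ → ℝ := fun l => (K₀ ^ l) ^ 2 * (Fintype.card (Fin l → Fin (Module.finrank ℝ ℝ³)) : ℝ) *
    (Fintype.card (Fin l → Fin (Module.finrank ℝ ℝ³)) : ℝ) with hc
  have hc0 : ∀ l, 0 ≤ c l := fun l => by positivity
  refine ⟨∑ l ∈ range (n + 1), c l, sum_nonneg fun l _ => hc0 l, fun L f hf => ?_⟩
  have hΩo : IsOpen (cylinderCell L : Set ℝ³) := (cylinderCell L).isOpen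
  -- one order at a time
  have hterm : ∀ l ∈ range (n + 1),
      ∫⁻ x in (cylinderCell L : Set ℝ³), ‖iteratedFDeriv ℝ l f x‖ₑ ^ 2 ≤
        ENNReal.ofReal (c l) * eSobolevDomainNorm n 2 (cylinderCell L) volume f ^ 2 := by
    intro l hl
    have hln : l ≤ n := Nat.lt_succ_iff.1 (mem_range.1 hl)
    set D : (Fin l → Fin (Module.finrank ℝ ℝ³)) → ℝ³ → F :=
      fun w => iterDeriv l (fun j => Module.finBasis ℝ ℝ³ (w (Fin.rev j))) f with hD
    -- pointwise bound, squared
    have hpt : ∀ x ∈ (cylinderCell L : Set ℝ³), ‖iteratedFDeriv ℝ l f x‖ₑ ^ 2 ≤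
        ENNReal.ofReal ((K₀ ^ l) ^ 2 * (Fintype.card (Fin l → Fin (Module.finrank ℝ ℝ³)) : ℝ)) *
          ∑ w : Fin l → Fin (Module.finrank ℝ ℝ³), ‖D w x‖ₑ ^ 2 := by
      intro x hx
      have h1 := norm_iteratedFDeriv_le_sum_iterDeriv hf l hx
      have h2 : ‖iteratedFDeriv ℝ l f x‖ ^ 2 ≤
          ((K₀ ^ l) ^ 2 * (Fintype.card (Fin l → Fin (Module.finrank ℝ ℝ³)) : ℝ)) *
            ∑ w : Fin l → Fin (Module.finrank ℝ ℝ³), ‖D w x‖ ^ 2 := by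
        have hcs := sq_sum_le_card_mul_sum_sq (s := (univ : Finset (Fin l → Fin (Module.finrank ℝ ℝ³))))
          (f := fun w => ‖D w x‖)
        rw [card_univ] at hcs
        calc ‖iteratedFDeriv ℝ l f x‖ ^ 2 ≤ (K₀ ^ l * ∑ w : Fin l → Fin (Module.finrank ℝ ℝ³), ‖D w x‖) ^ 2 :=
              pow_le_pow_left₀ (norm_nonneg _) h1 2
          _ = (K₀ ^ l) ^ 2 * (∑ w : Fin l → Fin (Module.finrank ℝ ℝ³), ‖D w x‖) ^ 2 := by ring
          _ ≤ (K₀ ^ l) ^ 2 * ((Fintype.card (Fin l → Fin (Module.finrank ℝ ℝ³)) : ℝ) *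
                ∑ w : Fin l → Fin (Module.finrank ℝ ℝ³), ‖D w x‖ ^ 2) :=
              mul_le_mul_of_nonneg_left hcs (by positivity)
          _ = _ := by ring
      calc ‖iteratedFDeriv ℝ l f x‖ₑ ^ 2 = ENNReal.ofReal (‖iteratedFDeriv ℝ l f x‖ ^ 2) := enorm_sq_eq_ofReal _
        _ ≤ _ := ENNReal.ofReal_le_ofReal h2
        _ = _ := by
            rw [ENNReal.ofReal_mul (by positivity), ENNReal.ofReal_sum_of_nonneg fun w _ => sq_nonneg _]
            simp only [enorm_sq_eq_ofReal]
    -- measurability of the word derivatives on the cell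
    have hDm : ∀ w : Fin l → Fin (Module.finrank ℝ ℝ³),
        AEMeasurable (fun x => ‖D w x‖ₑ ^ 2) (volume.restrict (cylinderCell L : Set ℝ³)) := fun w =>
      (((ContDiffOn.iterDeriv_of_isOpen hΩo l _ hf).continuousOn.aestronglyMeasurable
        hΩo.measurableSet).enorm.pow_const 2)
    have hcl : ENNReal.ofReal ((K₀ ^ l) ^ 2 * (Fintype.card (Fin l → Fin (Module.finrank ℝ ℝ³)) : ℝ)) *
        (Fintype.card (Fin l → Fin (Module.finrank ℝ ℝ³)) : ℝ≥0∞) = ENNReal.ofReal (c l) := by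
      rw [hc]
      dsimp only
      rw [← ENNReal.ofReal_natCast (Fintype.card (Fin l → Fin (Module.finrank ℝ ℝ³))),
        ← ENNReal.ofReal_mul (by positivity)]
    calc ∫⁻ x in (cylinderCell L : Set ℝ³), ‖iteratedFDeriv ℝ l f x‖ₑ ^ 2
        ≤ ∫⁻ x in (cylinderCell L : Set ℝ³),
            ENNReal.ofReal ((K₀ ^ l) ^ 2 * (Fintype.card (Fin l → Fin (Module.finrank ℝ ℝ³)) : ℝ)) *
              ∑ w : Fin l → Fin (Module.finrank ℝ ℝ³), ‖D w x‖ₑ ^ 2 :=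
          setLIntegral_mono' hΩo.measurableSet hpt
      _ = ENNReal.ofReal ((K₀ ^ l) ^ 2 * (Fintype.card (Fin l → Fin (Module.finrank ℝ ℝ³)) : ℝ)) *
            ∑ w : Fin l → Fin (Module.finrank ℝ ℝ³), ∫⁻ x in (cylinderCell L : Set ℝ³), ‖D w x‖ₑ ^ 2 := by
          rw [lintegral_const_mul' _ _ ENNReal.ofReal_ne_top, lintegral_finsetSum' _ fun w _ => hDm w]
      _ ≤ ENNReal.ofReal ((K₀ ^ l) ^ 2 * (Fintype.card (Fin l → Fin (Module.finrank ℝ ℝ³)) : ℝ)) *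
            ∑ _w : Fin l → Fin (Module.finrank ℝ ℝ³), eSobolevDomainNorm n 2 (cylinderCell L) volume f ^ 2 := by
          refine mul_le_mul_of_nonneg_left (sum_le_sum fun w _ => ?_) bot_le
          rw [← eLpNorm_two_sq_eq]
          exact pow_le_pow_left₀ bot_le (eLpNorm_iterDeriv_le_eSobolevDomainNorm hln hf _) 2
      _ = ENNReal.ofReal (c l) * eSobolevDomainNorm n 2 (cylinderCell L) volume f ^ 2 := by
          rw [sum_const, card_univ, nsmul_eq_mul, ← mul_assoc, hcl]
  calc cellEnergy L n f
      = ∑ l ∈ range (n + 1), ∫⁻ x in (cylinderCell L : Set ℝ³), ‖iteratedFDeriv ℝ l f x‖ₑ ^ 2 := rfl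
    _ ≤ ∑ l ∈ range (n + 1), ENNReal.ofReal (c l) * eSobolevDomainNorm n 2 (cylinderCell L) volume f ^ 2 :=
        sum_le_sum hterm
    _ = ENNReal.ofReal (∑ l ∈ range (n + 1), c l) * eSobolevDomainNorm n 2 (cylinderCell L) volume f ^ 2 := by
        rw [← sum_mul, ENNReal.ofReal_sum_of_nonneg fun l _ => hc0 l]

end CellEnergy

/-! ### The lattice energy of the extended datum -/

section Lattice

omit [NormedSpace ℝ F] in
/-- `ofReal (∫ ‖G‖²) = ∫⁻ ‖G‖ₑ²` for a smooth torus field. [folklore] -/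
theorem ofReal_integral_norm_sq {F' : Type*} [NormedAddCommGroup F'] [NormedSpace ℝ F']
    {G : UnitAddTorus (Fin 3) → F'} (hG : IsSmooth G) :
    ENNReal.ofReal (∫ ξ, ‖G ξ‖ ^ 2) = ∫⁻ ξ, ‖G ξ‖ₑ ^ 2 := by
  have hi : Integrable (fun ξ => ‖G ξ‖ ^ 2) volume := (hG.memLp 2).norm.integrable_sq
  rw [ofReal_integral_eq_lintegral_ofReal hi (ae_of_all _ fun _ => sq_nonneg _)]
  exact lintegral_congr fun ξ => (enorm_sq_eq_ofReal _).symm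

/-- `s_w² / (16 L) ≤ (max 4 L)^{2m} / (16 L)` for `|w| ≤ m`. [folklore] -/
theorem boxScale_sq_div_le {L : ℝ} (hL : 0 < L) {m : ℕ} {w : List (Fin 3)} (hw : w.length ≤ m) :
    boxScale L w ^ 2 / (16 * L) ≤ (max 4 L) ^ (2 * m) / (16 * L) := by
  refine div_le_div_of_nonneg_right ?_ (by positivity)
  have h1 : boxScale L w ≤ (max 4 L) ^ w.length := boxScale_le_pow hL w
  have hM : (1 : ℝ) ≤ max 4 L := le_max_of_le_left (by norm_num)
  calc boxScale L w ^ 2 ≤ ((max 4 L) ^ w.length) ^ 2 := pow_le_pow_left₀ (boxScale_pos hL w).le h1 2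
    _ = (max 4 L) ^ (2 * w.length) := by rw [← pow_mul, mul_comm]
    _ ≤ (max 4 L) ^ (2 * m) := pow_le_pow_right₀ hM (by omega)

/-- **The lattice energy of the extended datum by the cell energy**: for `f` smooth on the closed
cylinder and `L`-periodic in `z`, the torus field `U = toTorus L (cylExtend f)` has
`∑_k (1 + |k|²)^m ‖Û(k)‖² ≤ C(L, m) 𝓔_m(f)`. [cite: KatoLai1984, §7 (7.1)] -/
theorem exists_latticeEnergy_toTorus_cylExtend_le {L : ℝ} (hL : 0 < L) (m : ℕ) : ∃ C : ℝ, 0 ≤ C ∧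
    ∀ (f : ℝ³ → ℝ³), ContDiffOn ℝ ∞ f 𝕂 → IsAxiallyPeriodic L f →
      ENNReal.ofReal (∑' k : Fin 3 → ℤ, (1 + freqNormSq k) ^ m *
          ‖mFourierCoeff (EuclideanSpace.complexify ∘ toTorus L (cylExtend f)) k‖ ^ 2) ≤
        ENNReal.ofReal C * cellEnergy L m f := by
  obtain ⟨CX, hCX0, hX⟩ := exists_lintegral_iteratedFDeriv_cylExtend_le (F := ℝ³) m
  set A : ℝ := (max 4 L) ^ (2 * m) / (16 * L) with hA
  have hA0 : 0 ≤ A := by positivity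
  refine ⟨4 ^ m * (4 * (A * CX)), by positivity, fun f hf hper => ?_⟩
  set E : ℝ³ → ℝ³ := cylExtend f with hEdef
  have hE : ContDiff ℝ ∞ E := contDiff_cylExtend hf
  have hperE : IsAxiallyPeriodic L E := isAxiallyPeriodic_cylExtend hper
  have h0E : VanishesOffCore E := vanishesOffCore_cylExtend f
  set U : UnitAddTorus (Fin 3) → ℝ³ := toTorus L E with hUdef
  have hU : IsSmooth U := isSmooth_toTorus hE hperE h0E
  set B : ℝ≥0∞ := ENNReal.ofReal (A * CX) * cellEnergy L m f with hB
  -- the bound for one coordinate word `r : Fin l → Fin 3`, `l ≤ m`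
  have hword : ∀ {l : ℕ} (r : Fin l → Fin 3), l ≤ m →
      ∫⁻ ξ, ‖Torus.wordDeriv (List.ofFn r) U ξ‖ₑ ^ 2 ≤ B := by
    intro l r hl
    have h1 := lintegral_wordDeriv_toTorus_sq_le hL hE hperE h0E (List.ofFn r)
    have h2 : ∫⁻ x in {x : ℝ³ | x 2 ∈ Ioo 0 L}, ‖iterDirDeriv (Torus.wordVecs (List.ofFn r)) E x‖ₑ ^ 2 ≤
        ∫⁻ x in {x : ℝ³ | x 2 ∈ Ioo 0 L}, ‖iteratedFDeriv ℝ l E x‖ₑ ^ 2 := by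
      refine lintegral_mono fun x => ?_
      rw [enorm_sq_eq_ofReal, enorm_sq_eq_ofReal]
      exact ENNReal.ofReal_le_ofReal (pow_le_pow_left₀ (norm_nonneg _)
        (norm_iterDirDeriv_wordVecs_le isOpen_univ hE.contDiffOn r (mem_univ x)) 2)
    have h3 := hX L f hf l hl
    have hs : ENNReal.ofReal (boxScale L (List.ofFn r) ^ 2 / (16 * L)) ≤ ENNReal.ofReal A :=
      ENNReal.ofReal_le_ofReal (boxScale_sq_div_le hL (by rw [List.length_ofFn]; exact hl))
    calc ∫⁻ ξ, ‖Torus.wordDeriv (List.ofFn r) U ξ‖ₑ ^ 2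
        ≤ ENNReal.ofReal (boxScale L (List.ofFn r) ^ 2 / (16 * L)) *
            ∫⁻ x in {x : ℝ³ | x 2 ∈ Ioo 0 L}, ‖iterDirDeriv (Torus.wordVecs (List.ofFn r)) E x‖ₑ ^ 2 := h1
      _ ≤ ENNReal.ofReal A * (ENNReal.ofReal CX * cellEnergy L m f) := mul_le_mul' hs (h2.trans h3)
      _ = B := by rw [hB, ← mul_assoc, ← ENNReal.ofReal_mul hA0]
  -- the order-zero word and the pure words
  have hzero : ENNReal.ofReal (∫ ξ, ‖U ξ‖ ^ 2) ≤ B := by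
    rw [ofReal_integral_norm_sq hU]
    have := hword (l := 0) (fun j => Fin.elim0 j) (Nat.zero_le m)
    rwa [List.ofFn_zero, Torus.wordDeriv_nil] at this
  have hpure : ∀ i : Fin 3, ENNReal.ofReal (∫ ξ, ‖Torus.wordDeriv (List.replicate m i) U ξ‖ ^ 2) ≤ B := by
    intro i
    rw [ofReal_integral_norm_sq (Torus.isSmooth_wordDeriv hU _)]
    have := hword (l := m) (fun _ : Fin m => i) le_rfl
    rwa [List.ofFn_const] at this
  -- Jensen–Plancherel on the torus
  have hT := Torus.tsum_weight_mul_norm_sq_le hU m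
  have hcard : ((Fintype.card (Fin 3) : ℝ) + 1) ^ m = 4 ^ m := by norm_num
  rw [hcard] at hT
  have hI0 : 0 ≤ ∫ ξ, ‖U ξ‖ ^ 2 := integral_nonneg fun _ => sq_nonneg _
  have hIi : ∀ i : Fin 3, 0 ≤ ∫ ξ, ‖Torus.wordDeriv (List.replicate m i) U ξ‖ ^ 2 := fun i =>
    integral_nonneg fun _ => sq_nonneg _
  calc ENNReal.ofReal (∑' k : Fin 3 → ℤ, (1 + freqNormSq k) ^ m *
          ‖mFourierCoeff (EuclideanSpace.complexify ∘ U) k‖ ^ 2)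
      ≤ ENNReal.ofReal (4 ^ m * ((∫ ξ, ‖U ξ‖ ^ 2) +
          ∑ i, ∫ ξ, ‖Torus.wordDeriv (List.replicate m i) U ξ‖ ^ 2)) := ENNReal.ofReal_le_ofReal hT
    _ = ENNReal.ofReal (4 ^ m) * (ENNReal.ofReal (∫ ξ, ‖U ξ‖ ^ 2) +
          ∑ i, ENNReal.ofReal (∫ ξ, ‖Torus.wordDeriv (List.replicate m i) U ξ‖ ^ 2)) := by
        rw [ENNReal.ofReal_mul (by positivity), ENNReal.ofReal_add hI0 (sum_nonneg fun i _ => hIi i),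
          ENNReal.ofReal_sum_of_nonneg fun i _ => hIi i]
    _ ≤ ENNReal.ofReal (4 ^ m) * (B + ∑ _i : Fin 3, B) :=
        mul_le_mul_of_nonneg_left (add_le_add hzero (sum_le_sum fun i _ => hpure i)) bot_le
    _ = ENNReal.ofReal (4 ^ m * (4 * (A * CX))) * cellEnergy L m f := by
        rw [sum_const, card_univ, Fintype.card_fin, hB]
        rw [show ENNReal.ofReal (A * CX) * cellEnergy L m f + 3 • (ENNReal.ofReal (A * CX) * cellEnergy L m f) =
          4 * (ENNReal.ofReal (A * CX) * cellEnergy L m f) by rw [nsmul_eq_mul]; ring]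
        rw [ENNReal.ofReal_mul (by positivity) (p := (4 : ℝ) ^ m),
          ENNReal.ofReal_mul (by positivity) (p := (4 : ℝ)) (q := A * CX), ENNReal.ofReal_ofNat]
        ring

end Lattice

end PeriodicCylinder

end Literature.Analysis.FluidPDE
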